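import Summits.CriticalPhenomena.SAWScalingLimit.Theses.SAWDevelopingMap
import Summits.CriticalPhenomena.SAWScalingLimit.Theorems.ObservableToSLE.Negative.Identification
import Summits.CriticalPhenomena.SAWScalingLimit.Theorems.BoundaryClosureNegative_Endgame
import Literature.Probability.RandomPlanarGeometry.HullRestrictionTests
import Literature.Probability.RandomPlanarGeometry.HullSubdomainPullback
import Literature.Probability.RandomPlanarGeometry.ConformalRectangle
import Literature.Probability.RandomPlanarGeometry.RestrictionHulls

/-!
# Crux `SAWDevelopingMap.ObservableToSLE` (stmt-CriticalPhenomena-10472), line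
`floor-ratio-restriction-bootstrap`, registered stub `stub_targetTransport`

Landing target: `Summits/CriticalPhenomena/SAWScalingLimit/Theorems/SAWDevelopingMapObservableToSLETargetTransport.lean` (`--supports stmt-CriticalPhenomena-10472`).
The theorem statement below is the REGISTERED stub signature verbatim (skeleton
`Cruxes/ObservableToSLE/Lines/floor-ratio-restriction-bootstrap.lean`, lead reshape 2026-08-16, stated
over tree vocabulary only); do not change a character of it.  Helper lemmas go above it in this file
(docstring on every declaration, fully proved, no new definitions).

## Proof outline

Two instances of the repaired `HexObservableLimit` (`∃ c ≠ 0` universal), divided: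
instance 1 is `(D, ρ, Λ, ![m₀, m], a, b, Φ, L, Lb, ψ)`, instance 2 is
`(D', ρ, Λ, ![m₀, m'], a, b', Φ − x₀, L, Lb', ψ)`, where `x₀ ∈ ℝ` is the boundary value of `Φ` at
the flat boundary point `b' := D'.pt 1` (`exists_real_hasBoundaryValue`: `L → Lb'` bounds
`Φ' = exp L` on the convex half-disc `D ∩ B(b', r)`, so `Φ` is Lipschitz there, extends to a
Lipschitz function on `ℂ` and hence has a limit at `b'`; the limit is real since a limit in `ℍ` would
pull `b' ∈ ∂D` into `D` by continuity of `Φ⁻¹`), and `Φ − x₀` is again a conformal equivalence onto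
`ℍ` with the same derivative (`exists_conformalEquiv_sub_real`).  The bump `ψ` is chosen with
`∫ ψ exp ((5/8) L) ≠ 0` (`exists_test_integral_ne_zero`, from the test-function lemma
`eq_zero_of_forall_integral`).  The two numerators `δ² Σ ψ F_δ` coincide and are eventually nonzero
(nonzero limit), so the quotient of the two limits is the limit of `F_δ(b'_δ) / F_δ(b_δ)`.
-/

noncomputable section

open scoped BigOperators Topology NNReal ENNReal Classical
open Filter Set MeasureTheory Metric
open Literature.Probability.LatticeModels (HexVertex hexGraph hexCenter)
open Literature.Probability.RandomPlanarGeometry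
open Literature.Probability.RandomPlanarGeometry.SAW
open UpperHalfPlane (upperHalfPlaneSet isOpen_upperHalfPlaneSet)

namespace Summit.CriticalPhenomena.SAWScalingLimit.Theorems.ObservableToSLE.FloorRatio

open Summit.CriticalPhenomena.SAWScalingLimit.Theses.SAWDevelopingMap (HexObservableLimit HexTight)
open Summit.CriticalPhenomena.SAWScalingLimit.Theorems.BoundaryClosure.Negative
  (eq_zero_of_forall_integral)

/-- **A nowhere-vanishing continuous weight is detected by some test function.**  If `G` is
continuous and nowhere zero on a nonempty open set `U`, some continuous compactly supported `ψ`
with `tsupport ψ ⊆ U` has `∫ ψ G ≠ 0` (contrapositive of `eq_zero_of_forall_integral`). [folklore] -/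
private theorem exists_test_integral_ne_zero {U : Set ℂ} (hU : IsOpen U) (hne : U.Nonempty)
    {G : ℂ → ℂ} (hG : ContinuousOn G U) (hG0 : ∀ z ∈ U, G z ≠ 0) :
    ∃ ψ : ℂ → ℂ, Continuous ψ ∧ HasCompactSupport ψ ∧ tsupport ψ ⊆ U ∧
      (∫ z, ψ z * G z) ≠ 0 := by
  by_contra h
  push Not at h
  obtain ⟨z₀, hz₀⟩ := hne
  exact hG0 z₀ hz₀ (eq_zero_of_forall_integral hU hG h hz₀)

/-- **Real translates of a conformal map onto `ℍ`.**  For a conformal equivalence `Φ : U → ℍ`, a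
real number `x₀` and a set `U' = U`, the translate `z ↦ Φ z - x₀` underlies a conformal equivalence
`U' → ℍ` (inverse `w ↦ Φ⁻¹ (w + x₀)`; real translations preserve `ℍ`).  Ahlfors, *Complex Analysis*
(1979), Ch. 3 §3. [folklore] -/
private theorem exists_conformalEquiv_sub_real {U U' : Set ℂ}
    (Φ : ConformalEquiv U upperHalfPlaneSet) (hU : U' = U) (x₀ : ℝ) :
    ∃ Ψ : ConformalEquiv U' upperHalfPlaneSet, (Ψ : ℂ → ℂ) = fun z => Φ z - x₀ := by
  subst hU
  refine ⟨{ toFun := fun z => Φ z - x₀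
            invFun := fun w => Φ.symm (w + x₀)
            source := U'
            target := upperHalfPlaneSet
            map_source' := fun z hz => ?_
            map_target' := fun w hw => ?_
            left_inv' := fun z hz => ?_
            right_inv' := fun w hw => ?_
            source_eq := rfl
            target_eq := rfl
            differentiableOn := Φ.differentiableOn_coe.sub_const _
            differentiableOn_symm := ?_ }, rfl⟩
  · have h : 0 < (Φ z).im := Φ.mapsTo hz
    show 0 < (Φ z - x₀).im
    simpa using h
  · have hw' : 0 < w.im := hw
    exact Φ.symm_mapsTo (show 0 < (w + (x₀ : ℂ)).im by simpa using hw')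
  · show Φ.symm (Φ z - x₀ + x₀) = z
    rw [sub_add_cancel, Φ.symm_apply_apply hz]
  · have hw' : 0 < w.im := hw
    show Φ (Φ.symm (w + x₀)) - x₀ = w
    rw [Φ.apply_symm_apply (show 0 < (w + (x₀ : ℂ)).im by simpa using hw'), add_sub_cancel_right]
  · show DifferentiableOn ℂ (fun w => Φ.symm (w + x₀)) upperHalfPlaneSet
    refine Φ.symm.differentiableOn_coe.comp (differentiableOn_id.add_const _) fun w hw => ?_
    have hw' : 0 < w.im := hw
    show 0 < (w + (x₀ : ℂ)).im
    simpa using hw'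

/-- **Boundary value at a flat boundary point.**  Let `Φ : U → ℍ` be a conformal equivalence of an
open set `U` which is a horizontal half-disc near the frontier point `x`
(`U ∩ B(x, ρ) = {im > im x} ∩ B(x, ρ)`), and suppose `Φ' = exp L` on `U` with `L → Lx` at `x` within
`U`.  Then `Φ` has a *real* boundary value at `x`: `Φ'` is bounded on the convex set
`U ∩ B(x, r)`, so `Φ` is Lipschitz there (mean value inequality), extends to a Lipschitz function on
`ℂ` and thus converges at `x`; the limit `p` has `im p ≥ 0`, and `im p > 0` is impossible since then
`Φ⁻¹`, continuous at `p ∈ ℍ`, would give `x = Φ⁻¹ p ∈ U`, contradicting `x ∈ ∂U` with `U` open.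
Pommerenke, *Boundary Behaviour of Conformal Maps* (1992), §2.1. [folklore] -/
private theorem exists_real_hasBoundaryValue {U : Set ℂ} (hU : IsOpen U)
    (Φ : ConformalEquiv U upperHalfPlaneSet) {L : ℂ → ℂ} {x Lx : ℂ} {ρ : ℝ} (hρ : 0 < ρ)
    (hflat : U ∩ ball x ρ = {z : ℂ | x.im < z.im} ∩ ball x ρ) (hx : x ∈ frontier U)
    (hexp : ∀ z ∈ U, Complex.exp (L z) = deriv Φ z)
    (hL : Tendsto L (𝓝[U] x) (𝓝 Lx)) :
    ∃ x₀ : ℝ, Φ.HasBoundaryValue x x₀ := by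
  -- a radius on which `L` is within `1` of its limit
  obtain ⟨r₀, hr₀, hr₀L⟩ := Metric.tendsto_nhdsWithin_nhds.1 hL 1 one_pos
  obtain ⟨r, hrpos, hrr₀, hrρ⟩ : ∃ r : ℝ, 0 < r ∧ r ≤ r₀ ∧ r ≤ ρ :=
    ⟨min r₀ ρ, lt_min hr₀ hρ, min_le_left _ _, min_le_right _ _⟩
  -- the convex half-disc `S = U ∩ B(x, r)`
  have hSU : U ∩ ball x r = {z : ℂ | x.im < z.im} ∩ ball x r := by
    ext z
    constructor
    · rintro ⟨hzU, hzr⟩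
      have hz : z ∈ U ∩ ball x ρ := ⟨hzU, ball_subset_ball hrρ hzr⟩
      rw [hflat] at hz
      exact ⟨hz.1, hzr⟩
    · rintro ⟨hz1, hzr⟩
      have hz : z ∈ {z : ℂ | x.im < z.im} ∩ ball x ρ := ⟨hz1, ball_subset_ball hrρ hzr⟩
      rw [← hflat] at hz
      exact ⟨hz.1, hzr⟩
  set S : Set ℂ := {z : ℂ | x.im < z.im} ∩ ball x r with hS
  have hSsub : S ⊆ U := by
    rw [← hSU]
    exact inter_subset_left
  have hnhds : 𝓝[U] x = 𝓝[S] x := by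
    rw [← hSU]
    exact nhdsWithin_restrict' U (ball_mem_nhds x hrpos)
  have hconv : Convex ℝ S := (convex_halfSpace_im_gt _).inter (convex_ball _ _)
  -- `Φ` is Lipschitz on `S`
  have hlip : LipschitzOnWith ⟨Real.exp (‖Lx‖ + 1), (Real.exp_pos _).le⟩ Φ S := by
    refine hconv.lipschitzOnWith_of_nnnorm_deriv_le (fun z hz => ?_) (fun z hz => ?_)
    · exact Φ.differentiableOn_coe.differentiableAt (hU.mem_nhds (hSsub hz))
    · have hzU : z ∈ U := hSsub hz
      have hd : dist (L z) Lx < 1 := hr₀L hzU (lt_of_lt_of_le (mem_ball.1 hz.2) hrr₀)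
      rw [dist_eq_norm] at hd
      rw [← NNReal.coe_le_coe, coe_nnnorm, ← hexp z hzU, Complex.norm_exp]
      change Real.exp (L z).re ≤ Real.exp (‖Lx‖ + 1)
      refine Real.exp_le_exp.2 ?_
      have h1 : (L z).re ≤ ‖L z‖ := Complex.re_le_norm _
      have h2 : ‖L z‖ ≤ ‖L z - Lx‖ + ‖Lx‖ := by
        calc ‖L z‖ = ‖(L z - Lx) + Lx‖ := by rw [sub_add_cancel]
          _ ≤ ‖L z - Lx‖ + ‖Lx‖ := norm_add_le _ _
      linarith
  -- hence `Φ` has a limit `g x` at `x` within `S`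
  obtain ⟨g, hg, hgeq⟩ := hlip.extend_finite_dimension
  have hT : Tendsto Φ (𝓝[S] x) (𝓝 (g x)) :=
    ((hg.continuous.tendsto x).mono_left nhdsWithin_le_nhds).congr'
      hgeq.eventuallyEq_nhdsWithin.symm
  have hne : (𝓝[S] x).NeBot := by
    rw [← hnhds]
    exact mem_closure_iff_nhdsWithin_neBot.1 (frontier_subset_closure hx)
  -- the limit has nonnegative imaginary part ...
  have him : Tendsto (fun z => (Φ z).im) (𝓝[S] x) (𝓝 (g x).im) :=
    (Complex.continuous_im.tendsto _).comp hT
  have hp0 : 0 ≤ (g x).im := by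
    refine ge_of_tendsto him (eventually_nhdsWithin_of_forall fun z hz => ?_)
    have h : 0 < (Φ z).im := Φ.mapsTo (hSsub hz)
    exact h.le
  -- ... which is in fact zero
  have hpim : (g x).im = 0 := by
    by_contra hne0
    have hpH : g x ∈ upperHalfPlaneSet := lt_of_le_of_ne hp0 (Ne.symm hne0)
    have hsymm : ContinuousAt Φ.symm (g x) :=
      Φ.symm.continuousOn.continuousAt (isOpen_upperHalfPlaneSet.mem_nhds hpH)
    have h1 : Tendsto (fun z => Φ.symm (Φ z)) (𝓝[S] x) (𝓝 (Φ.symm (g x))) :=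
      hsymm.tendsto.comp hT
    have h2 : Tendsto (fun z : ℂ => z) (𝓝[S] x) (𝓝 (Φ.symm (g x))) :=
      h1.congr' (eventually_nhdsWithin_of_forall fun z hz => Φ.symm_apply_apply (hSsub hz))
    have h3 : Tendsto (fun z : ℂ => z) (𝓝[S] x) (𝓝 x) :=
      tendsto_id.mono_left nhdsWithin_le_nhds
    have hx' : Φ.symm (g x) = x := tendsto_nhds_unique h2 h3
    have hxU : x ∈ U := hx' ▸ Φ.symm_mapsTo hpH
    have hmem : x ∈ U ∩ frontier U := ⟨hxU, hx⟩
    rw [hU.inter_frontier_eq] at hmem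
    exact hmem
  refine ⟨(g x).re, ?_⟩
  show Tendsto Φ (𝓝[U] x) (𝓝 (((g x).re : ℝ) : ℂ))
  rw [hnhds]
  convert hT using 2
  apply Complex.ext <;> simp [hpim]

/-- STUB 1 — `TargetTransport = HexObservableLimit → FloorRatioLimit` (size M–L; provable now —
triagers 1–3 checked it clause by clause; rev-4 form).  Two instances of the repaired
`HexObservableLimit`: `(D, ρ, Λ, ![m₀, m], a, b, Φ, L, Lb, ψ)` and
`(D', ρ, Λ, ![m₀, m'], a, b', Φ − x₀, L, Lb', ψ)` where `x₀ ∈ ℝ` is the boundary value of `Φ` at the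
flat point `D'.pt 1` (exists: `L → Lb'` bounds `Φ' = e^L` on the convex half-disc `D ∩ B(b', ρ')`,
so `Φ` is Lipschitz there and extends continuously; the value is real because a limit value in `ℍ`
would pull `b' ∈ ∂D` back into `D` by continuity of `Φ⁻¹`); `Φ − x₀` is again a `ConformalEquiv`
onto `ℍ` (real translation), `‖Φ − x₀‖ → ∞` at `a`, boundary value `0` at `b'`, same derivative hence
the same `L`; one bump `ψ` with `∫ ψ e^{(5/8)L} ≠ 0` (exists since `e^{(5/8)L}` is continuous and
nowhere zero on the open set `D`: test-function lemma `eq_zero_of_forall_integral` of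
`BoundaryClosureNegative_Endgame`); the numerators `δ²Σψ F_δ` agree, are eventually `≠ 0` (nonzero
limit), divide the two limits (`Filter.Tendsto.div`, `c ≠ 0`).
Sources: DuminilCopinSmirnov2012 Conj. 2 (arXiv:1007.0575 p. 7); KennedyLawler2013 (lattice
boundary factors are local — consistent). -/
theorem stub_targetTransport : HexObservableLimit →
  ∀ (D D' : DobrushinDomain) (ρ : ℝ) (Λ : ℝ → Finset HexVertex) (m₀ m m' : ℝ → ℤ)
  (a b b' : ℝ → Sym2 HexVertex) (Φ : ConformalEquiv D.carrier upperHalfPlaneSet)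
  (L : ℂ → ℂ) (Lb Lb' : ℂ),
  D'.carrier = D.carrier → D'.pt 0 = D.pt 0 → 0 < ρ →
  D.carrier ∩ ball (D.pt 0) ρ = {z : ℂ | (D.pt 0).im < z.im} ∩ ball (D.pt 0) ρ →
  D.carrier ∩ ball (D.pt 1) ρ = {z : ℂ | (D.pt 1).im < z.im} ∩ ball (D.pt 1) ρ →
  D.carrier ∩ ball (D'.pt 1) ρ = {z : ℂ | (D'.pt 1).im < z.im} ∩ ball (D'.pt 1) ρ →
  (∀ᶠ δ : ℝ in 𝓝[>] 0,
  hexDomainSimplyConnected (Λ δ) ∧ a δ ∈ hexDomainBoundary (Λ δ) ∧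
  b δ ∈ hexDomainBoundary (Λ δ) ∧ b' δ ∈ hexDomainBoundary (Λ δ) ∧
  Nonempty (HexMidEdgeSAW (Λ δ) (a δ) (b δ)) ∧ Nonempty (HexMidEdgeSAW (Λ δ) (a δ) (b' δ)) ∧
  (hexGraph.induce (↑(Λ δ) : Set HexVertex)).Preconnected ∧
  (∀ v ∈ Λ δ, (δ : ℂ) * hexCenter v ∈ D.carrier) ∧
  (∀ v : HexVertex, (δ : ℂ) * hexCenter v ∈ ball (D.pt 0) ρ → (v ∈ Λ δ ↔ m₀ δ ≤ v.1 1)) ∧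
  (∀ v : HexVertex, (δ : ℂ) * hexCenter v ∈ ball (D.pt 1) ρ → (v ∈ Λ δ ↔ m δ ≤ v.1 1)) ∧
  (∀ v : HexVertex, (δ : ℂ) * hexCenter v ∈ ball (D'.pt 1) ρ → (v ∈ Λ δ ↔ m' δ ≤ v.1 1))) →
  (∀ K : Set ℂ, IsCompact K → K ⊆ D.carrier →
  ∀ᶠ δ : ℝ in 𝓝[>] 0, ∀ v : HexVertex, (δ : ℂ) * hexCenter v ∈ K → v ∈ Λ δ) →
  Tendsto (fun δ : ℝ => (δ : ℂ) * hexMidpoint (a δ)) (𝓝[>] 0) (𝓝 (D.pt 0)) →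
  Tendsto (fun δ : ℝ => (δ : ℂ) * hexMidpoint (b δ)) (𝓝[>] 0) (𝓝 (D.pt 1)) →
  Tendsto (fun δ : ℝ => (δ : ℂ) * hexMidpoint (b' δ)) (𝓝[>] 0) (𝓝 (D'.pt 1)) →
  Tendsto (fun x => ‖Φ x‖) (𝓝[D.carrier] (D.pt 0)) atTop →
  Φ.HasBoundaryValue (D.pt 1) 0 →
  ContinuousOn L D.carrier → (∀ z ∈ D.carrier, Complex.exp (L z) = deriv Φ z) →
  Tendsto L (𝓝[D.carrier] (D.pt 1)) (𝓝 Lb) → Tendsto L (𝓝[D.carrier] (D'.pt 1)) (𝓝 Lb') →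
  Tendsto (fun δ : ℝ =>
      hexParafermionicObservable (Λ δ) (a δ) hexCriticalFugacity (5 / 8) (b' δ) /
        hexParafermionicObservable (Λ δ) (a δ) hexCriticalFugacity (5 / 8) (b δ)) (𝓝[>] 0)
    (𝓝 (Complex.exp ((5 / 8 : ℂ) * (Lb' - Lb)))) := by
  intro hO D D' ρ Λ m₀ m m' a b b' Φ L Lb Lb' hcar hpt0 hρ hflat0 hflat1 hflat1' hev hK ha hb hb'
    hΦinf hΦbv hLc hexp hLb hLb'
  obtain ⟨c, hc, H⟩ := hO
  -- the test function `ψ`, with `∫ ψ exp ((5/8) L) ≠ 0`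
  obtain ⟨ψ, hψc, hψK, hψs, hJ⟩ := exists_test_integral_ne_zero D.isOpen D.nonempty
    (G := fun z => Complex.exp ((5 / 8 : ℂ) * L z)) ((continuousOn_const.mul hLc).cexp)
    (fun z _ => Complex.exp_ne_zero _)
  have hI : ∀ M : ℂ, ∫ z, ψ z * Complex.exp ((5 / 8 : ℂ) * (L z - M)) =
      Complex.exp (-((5 / 8 : ℂ) * M)) * ∫ z, ψ z * Complex.exp ((5 / 8 : ℂ) * L z) := by
    intro M
    rw [← integral_const_mul]
    congr 1 with z
    rw [mul_sub, sub_eq_add_neg, Complex.exp_add]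
    ring
  -- the real boundary value `x₀` of `Φ` at `b' = D'.pt 1` and the translate `Φ - x₀` on `D'`
  obtain ⟨x₀, hx₀⟩ := exists_real_hasBoundaryValue D.isOpen Φ hρ hflat1'
    (by rw [← hcar]; exact D'.pt_mem_frontier 1) hexp hLb'
  obtain ⟨Φ₃, hΦ₃⟩ := exists_conformalEquiv_sub_real Φ hcar x₀
  -- instance 1: `(D, ![m₀, m], b, Φ, Lb)`
  have hflatD : ∀ i : Fin 2, D.carrier ∩ ball (D.pt i) ρ =
      {z : ℂ | (D.pt i).im < z.im} ∩ ball (D.pt i) ρ :=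
    Fin.forall_fin_two.2 ⟨hflat0, hflat1⟩
  have hev1 : ∀ᶠ δ : ℝ in 𝓝[>] 0, hexDomainSimplyConnected (Λ δ) ∧
      a δ ∈ hexDomainBoundary (Λ δ) ∧ b δ ∈ hexDomainBoundary (Λ δ) ∧
      Nonempty (HexMidEdgeSAW (Λ δ) (a δ) (b δ)) ∧
      (hexGraph.induce (↑(Λ δ) : Set HexVertex)).Preconnected ∧
      (∀ v ∈ Λ δ, (δ : ℂ) * hexCenter v ∈ D.carrier) ∧
      (∀ i : Fin 2, ∀ v : HexVertex, (δ : ℂ) * hexCenter v ∈ ball (D.pt i) ρ →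
        (v ∈ Λ δ ↔ ![m₀, m] i δ ≤ v.1 1)) := by
    filter_upwards [hev] with δ h
    obtain ⟨h1, h2, h3, -, h5, -, h7, h8, h9, h10, -⟩ := h
    exact ⟨h1, h2, h3, h5, h7, h8, Fin.forall_fin_two.2 ⟨h9, h10⟩⟩
  have T₁ : Tendsto (fun δ : ℝ => (δ : ℂ) ^ 2 * (∑ᶠ e ∈ hexDomainMidEdges (Λ δ),
      ψ ((δ : ℂ) * hexMidpoint e) *
        hexParafermionicObservable (Λ δ) (a δ) hexCriticalFugacity (5 / 8) e) /
      hexParafermionicObservable (Λ δ) (a δ) hexCriticalFugacity (5 / 8) (b δ)) (𝓝[>] 0)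
      (𝓝 (c * ∫ z, ψ z * Complex.exp ((5 / 8 : ℂ) * (L z - Lb)))) :=
    H D ρ Λ ![m₀, m] a b Φ L Lb ψ hρ hflatD hev1 hK ha hb hΦinf hΦbv hLc hexp hLb hψc hψK hψs
  -- instance 2: `(D', ![m₀, m'], b', Φ - x₀, Lb')`
  have hflatD' : ∀ i : Fin 2, D'.carrier ∩ ball (D'.pt i) ρ =
      {z : ℂ | (D'.pt i).im < z.im} ∩ ball (D'.pt i) ρ := by
    refine Fin.forall_fin_two.2 ⟨?_, ?_⟩
    · rw [hcar, hpt0]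
      exact hflat0
    · rw [hcar]
      exact hflat1'
  have hev2 : ∀ᶠ δ : ℝ in 𝓝[>] 0, hexDomainSimplyConnected (Λ δ) ∧
      a δ ∈ hexDomainBoundary (Λ δ) ∧ b' δ ∈ hexDomainBoundary (Λ δ) ∧
      Nonempty (HexMidEdgeSAW (Λ δ) (a δ) (b' δ)) ∧
      (hexGraph.induce (↑(Λ δ) : Set HexVertex)).Preconnected ∧
      (∀ v ∈ Λ δ, (δ : ℂ) * hexCenter v ∈ D'.carrier) ∧
      (∀ i : Fin 2, ∀ v : HexVertex, (δ : ℂ) * hexCenter v ∈ ball (D'.pt i) ρ →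
        (v ∈ Λ δ ↔ ![m₀, m'] i δ ≤ v.1 1)) := by
    filter_upwards [hev] with δ h
    obtain ⟨h1, h2, -, h4, -, h6, h7, h8, h9, -, h11⟩ := h
    refine ⟨h1, h2, h4, h6, h7, fun v hv => ?_, Fin.forall_fin_two.2 ⟨fun v hv => ?_, h11⟩⟩
    · rw [hcar]
      exact h8 v hv
    · rw [hpt0] at hv
      exact h9 v hv
  have hK' : ∀ K : Set ℂ, IsCompact K → K ⊆ D'.carrier →
      ∀ᶠ δ : ℝ in 𝓝[>] 0, ∀ v : HexVertex, (δ : ℂ) * hexCenter v ∈ K → v ∈ Λ δ :=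
    fun K hKc hKs => hK K hKc (by rw [← hcar]; exact hKs)
  have ha' : Tendsto (fun δ : ℝ => (δ : ℂ) * hexMidpoint (a δ)) (𝓝[>] 0) (𝓝 (D'.pt 0)) := by
    rw [hpt0]
    exact ha
  have hΦ₃inf : Tendsto (fun x => ‖Φ₃ x‖) (𝓝[D'.carrier] (D'.pt 0)) atTop := by
    rw [hΦ₃, hcar, hpt0]
    refine tendsto_atTop_mono (fun x => ?_)
      (tendsto_atTop_add_const_right _ (-‖(x₀ : ℂ)‖) hΦinf)
    have h := norm_sub_norm_le (Φ x) (x₀ : ℂ)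
    simp only
    linarith
  have hΦ₃bv : Φ₃.HasBoundaryValue (D'.pt 1) 0 := by
    show Tendsto Φ₃ (𝓝[D'.carrier] (D'.pt 1)) (𝓝 0)
    rw [hΦ₃, hcar]
    simpa using hx₀.sub_const (x₀ : ℂ)
  have hexp' : ∀ z ∈ D'.carrier, Complex.exp (L z) = deriv Φ₃ z := by
    intro z hz
    rw [hΦ₃, deriv_sub_const, hexp z (by rw [← hcar]; exact hz)]
  have hLc' : ContinuousOn L D'.carrier := by
    rw [hcar]
    exact hLc
  have hLb'2 : Tendsto L (𝓝[D'.carrier] (D'.pt 1)) (𝓝 Lb') := by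
    rw [hcar]
    exact hLb'
  have hψs' : tsupport ψ ⊆ D'.carrier := by
    rw [hcar]
    exact hψs
  have T₂ : Tendsto (fun δ : ℝ => (δ : ℂ) ^ 2 * (∑ᶠ e ∈ hexDomainMidEdges (Λ δ),
      ψ ((δ : ℂ) * hexMidpoint e) *
        hexParafermionicObservable (Λ δ) (a δ) hexCriticalFugacity (5 / 8) e) /
      hexParafermionicObservable (Λ δ) (a δ) hexCriticalFugacity (5 / 8) (b' δ)) (𝓝[>] 0)
      (𝓝 (c * ∫ z, ψ z * Complex.exp ((5 / 8 : ℂ) * (L z - Lb')))) :=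
    H D' ρ Λ ![m₀, m'] a b' Φ₃ L Lb' ψ hρ hflatD' hev2 hK' ha' hb' hΦ₃inf hΦ₃bv hLc' hexp' hLb'2
      hψc hψK hψs'
  -- divide the two limits
  rw [hI] at T₁ T₂
  have hlim1 : c * (Complex.exp (-((5 / 8 : ℂ) * Lb)) *
      ∫ z, ψ z * Complex.exp ((5 / 8 : ℂ) * L z)) ≠ 0 :=
    mul_ne_zero hc (mul_ne_zero (Complex.exp_ne_zero _) hJ)
  have hlim2 : c * (Complex.exp (-((5 / 8 : ℂ) * Lb')) *
      ∫ z, ψ z * Complex.exp ((5 / 8 : ℂ) * L z)) ≠ 0 :=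
    mul_ne_zero hc (mul_ne_zero (Complex.exp_ne_zero _) hJ)
  have hA : ∀ᶠ δ : ℝ in 𝓝[>] 0, (δ : ℂ) ^ 2 * (∑ᶠ e ∈ hexDomainMidEdges (Λ δ),
      ψ ((δ : ℂ) * hexMidpoint e) *
        hexParafermionicObservable (Λ δ) (a δ) hexCriticalFugacity (5 / 8) e) ≠ 0 := by
    filter_upwards [T₁.eventually_ne hlim1] with δ hδ h0
    apply hδ
    rw [h0, zero_div]
  have hval : c * (Complex.exp (-((5 / 8 : ℂ) * Lb)) * ∫ z, ψ z * Complex.exp ((5 / 8 : ℂ) * L z)) /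
      (c * (Complex.exp (-((5 / 8 : ℂ) * Lb')) * ∫ z, ψ z * Complex.exp ((5 / 8 : ℂ) * L z))) =
      Complex.exp ((5 / 8 : ℂ) * (Lb' - Lb)) := by
    rw [mul_div_mul_left _ _ hc, mul_div_mul_right _ _ hJ, ← Complex.exp_sub]
    congr 1
    ring
  have T := T₁.div T₂ hlim2
  rw [hval] at T
  refine T.congr' ?_
  filter_upwards [hA] with δ hδ
  simp only [Pi.div_apply]
  exact div_div_div_cancel_left' _ _ hδ

end Summit.CriticalPhenomena.SAWScalingLimit.Theorems.ObservableToSLE.FloorRatio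

end
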